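/-
Copyright (c) 2026 the pub-hodgecm-mathlib formalisation cell (harness21).  Prover seat hodgecm-mathlib-K2E4-p11 (g9): Track B «K2-LIT»,
hLiu418 = stmt-HodgeConjecture-24832, socket #41 KIND W, organ «Φ6b-ind» FILE 2b (LEAD F0P6-plan (g14) BATCH #178 (1), KW desk F0P2-p08 (g3)):
THE CAYLEY CALCULUS OF SHIMURA's ξ-INTEGRAND ON `Herm₂(ℂ)` — line derivatives in the chart and the identity
`L Φ_{α,β} = (α+β−1)(α Φ_{α+1,β} + β Φ_{α,β+1}) + 4αβ·det(g)·Φ_{α+1,β+1}`, `L = ∂_a∂_b − ¼(∂_u² + ∂_v²)`.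
THEOREMS ONLY (no `def`, no `instance`, no `notation`, no named-fact hypothesis, no `sorry`).
-/
import Summits.HodgeConjecture.HodgeConjecture.Theorems.K2LiuHermTwoXiIntegrandLineDeriv   -- FILE 2a (this seat): slit plane, index shifts, first line derivatives
import HarnessLib

/-!
# Crux `HLiu418`, ROAD Φ ∕ KIND W organ «Φ6b-ind», FILE 2b: the CAYLEY IDENTITIES of the ξ-integrand on `Herm₂(ℂ)` (the Cayley calculus, second half)

Cell `hodgecm-mathlib`, crux item hLiu418 = `stmt-HodgeConjecture-24832` (helper lane `--supports … --as helper`, count-neutral), route of record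
`HCCMUnconditional`; squad K2 ∕ K2Liu, road `K2_Liu`, socket #41, KIND W.  Sequel of ★ FILE 1 `K2LiuHermTwoXiEtaIdentityIndefinite` (the ξ–η identity at
every signature).  THE GOAL OF FILES 2–4: Shimura's `ξ(g, h; α, β)` (★ `xiTwo`), absolutely convergent on the HALF-SPACE `{re(α+β) > 3}` (★
`integrable_xiTwoIntegrand`), is ENTIRE in `(α, β)` for every NON-DEGENERATE Hermitian index `h` — definite or INDEFINITE alike — by an elementary
three-term recursion raising `α + β`, obtained from two integrations by parts against the oscillation `e(−τ(hx))` [Shimura1982, §3 (3.4)–(3.7)-type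
recursion formulas; the continuation statement is Thm. 3.1 ∕ Thm. 4.2 without the growth].  FILE 2a `K2LiuHermTwoXiIntegrandLineDeriv` is the first-order calculus (its §1–§3 are quoted below
for orientation); THIS FILE (2b) is §4: second line derivatives and the two Cayley identities; FILE 3 integrates by parts, FILE 4 runs the induction.

THE CALCULUS (chart `x = hermTwo (a, z, b)`, `z = u + iv`, Lebesgue coordinates `(a, u, v, b)`; `g` ANY complex `2 × 2` matrix for the algebra, `g > 0` where
branches are differentiated).  Write `Y = g − ix`, `W = g + ix`, `P = det Y`, `Q = det W`, and `Φ_{α,β} := xiTwoIntegrand g 0 α β`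
`= e^{−iπα} P^{−α} · e^{iπβ} Q^{−β}` (the ξ-integrand WITHOUT its character; `xiTwoIntegrand g h α β = e(−τ(hx)) · Φ_{α,β}`, §2).  Along a chart direction
`v` (matrix `V = hermTwo v`): `Y(x + tV) = Y − t·iV`, so `det` is quadratic in `t` with linear coefficient the polarisation `tr(adj(Y)·V)` (§1
`det_sub_smul_fin_two`), `adj` is linear (`2 × 2`), and `P, Q` stay in the slit plane (★ `det_sub_I_smul_mem_slitPlane` (K2Liu-p11) and its conjugate FILE 2a `det_add_I_smul_hermTwo_mem_slitPlane`), whence (§3)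
  `D_v Φ_{α,β} = −iα·tr(adj(Y)V)·Φ_{α+1,β} + iβ·tr(adj(W)V)·Φ_{α,β+1}`      (`Φ_{α+1,β} = −P⁻¹Φ_{α,β}`, `Φ_{α,β+1} = −Q⁻¹Φ_{α,β}`, §2),
  `D_{v′} tr(adj(Y)V) = −i·tr(adj(V′)V)`, `D_{v′} tr(adj(W)V) = i·tr(adj(V′)V)`,  `D_v e(−τ(hx)) = −2πi·τ(hV)·e(−τ(hx))`.
With the four directions `e_a = (1,0,0)`, `e_u = (0,1,0)`, `e_v = (0,i,0)`, `e_b = (0,0,1)` and `L := D_{e_b}D_{e_a} − ¼(D_{e_u}D_{e_u} + D_{e_v}D_{e_v})` (the Cayley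
operator `det(∂_x)`: `L P^s = −s(s+1)P^{s−1}`, carré du champ `Γ(P,Q) = 2 det g − (P+Q)∕2`), §4 proves the CAYLEY IDENTITIES
  **`L Φ_{α,β} = (α+β−1)·(α Φ_{α+1,β} + β Φ_{α,β+1}) + 4αβ·det(g)·Φ_{α+1,β+1}`**   and   **`L e(−τ(hx)) = −4π²·det(h)·e(−τ(hx))`** (any `h`),
stated on the explicit second line-derivative expressions that FILE 3 feeds to Mathlib's `integral_bilinear_hasLineDerivAt_right_eq_neg_left_of_integrable`.
Sanity check of the constants (done by hand, reproduced in FILE 3's docstring): at `h = 0` against ★ `xiTwo_zero_right` the recursion's right-hand side vanishes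
identically (`det(2g) = 4 det g`).
[Shimura1982, §1 (1.25), §3] [Shimura1997, §16.4–16.5] [FarautKoranyi1994, Ch. VII §1 (Cayley-type identity `det(∂) det(x)^s = b(s) det(x)^{s−1}`)].
HONEST LABEL.  Count-neutral helper of the K2_Liu road; it pays no socket by itself: `HC_CM` is proved only modulo the 7 printed citations
(2 remaining named inputs: hLiu418 = `stmt-HodgeConjecture-24832`, h413 = `stmt-HodgeConjecture-24833`) until rung 0 closes.

## References
* [Shimura1982] G. Shimura, *Confluent hypergeometric functions on tube domains*, Math. Ann. 260 (1982) 269–302: §1 (1.25), §3.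
* [Shimura1997] G. Shimura, *Euler Products and Eisenstein Series*, CBMS 93 (1997): §16.4–16.5.
* [FarautKoranyi1994] J. Faraut, A. Korányi, *Analysis on Symmetric Cones* (1994): Ch. VII §1.
-/

set_option autoImplicit false
-- the mandated namespace repeats the single-problem summit's segment (`HodgeConjecture.HodgeConjecture`)
set_option linter.dupNamespace false

noncomputable section

open Complex MeasureTheory Set
open scoped ComplexOrder ComplexConjugate

namespace Summit.HodgeConjecture.HodgeConjecture.Cruxes.HLiu418.K2LiuHermTwoXiIntegrandCayley

open Summit.HodgeConjecture.HodgeConjecture.Cruxes.HLiu418.K2LiuHermTwoGammaDefs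
open Summit.HodgeConjecture.HodgeConjecture.Cruxes.HLiu418.K2LiuHermTwoDetPowerFibres
open Summit.HodgeConjecture.HodgeConjecture.Cruxes.HLiu418.K2LiuHermTwoDetPowerIntegrable
open Summit.HodgeConjecture.HodgeConjecture.Cruxes.HLiu418.K2LiuHermTwoConfluentXiDefs
open Summit.HodgeConjecture.HodgeConjecture.Cruxes.HLiu418.K2LiuHermTwoEtaDefs
open Summit.HodgeConjecture.HodgeConjecture.Cruxes.HLiu418.K2LiuHermTwoXiIntegrandLineDeriv

/-! ## §4 Second line derivatives and the Cayley identities -/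

/-- **SECOND LINE DERIVATIVE OF `Φ_{α,β}`** (direction `v`, then `v′`), by the product rule on §3's first derivative: with `V = hermTwo v`,
`V′ = hermTwo v′`, `Y = g − ix`, `W = g + ix`,
`D_{v′}D_v Φ_{α,β} = −iα·[−i tr(adj(V′)V)·Φ_{α+1,β} + tr(adj(Y)V)·D_{v′}Φ_{α+1,β}] + iβ·[i tr(adj(V′)V)·Φ_{α,β+1} + tr(adj(W)V)·D_{v′}Φ_{α,β+1}]`.
[cite: Shimura1982, §3] -/
theorem hasLineDerivAt_lineDeriv_xiTwoIntegrand_zero {g : Matrix (Fin 2) (Fin 2) ℂ} (hg : g.PosDef) (α β : ℂ) (c v v' : ℝ × ℂ × ℝ) :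
    HasLineDerivAt ℝ (fun c : ℝ × ℂ × ℝ => lineDeriv ℝ (xiTwoIntegrand g 0 α β) c v)
      ((-(I * α * (-(I * ((hermTwo v').adjugate * hermTwo v).trace))) * xiTwoIntegrand g 0 (α + 1) β c +
          -(I * α * ((g - I • hermTwo c).adjugate * hermTwo v).trace) *
            (-(I * (α + 1) * ((g - I • hermTwo c).adjugate * hermTwo v').trace) * xiTwoIntegrand g 0 (α + 1 + 1) β c +
              I * β * ((g + I • hermTwo c).adjugate * hermTwo v').trace * xiTwoIntegrand g 0 (α + 1) (β + 1) c)) +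
        (I * β * (I * ((hermTwo v').adjugate * hermTwo v).trace) * xiTwoIntegrand g 0 α (β + 1) c +
          I * β * ((g + I • hermTwo c).adjugate * hermTwo v).trace *
            (-(I * α * ((g - I • hermTwo c).adjugate * hermTwo v').trace) * xiTwoIntegrand g 0 (α + 1) (β + 1) c +
              I * (β + 1) * ((g + I • hermTwo c).adjugate * hermTwo v').trace * xiTwoIntegrand g 0 α (β + 1 + 1) c))) c v' := by
  have hfun : (fun c : ℝ × ℂ × ℝ => lineDeriv ℝ (xiTwoIntegrand g 0 α β) c v) = fun c : ℝ × ℂ × ℝ =>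
      -(I * α * ((g - I • hermTwo c).adjugate * hermTwo v).trace) * xiTwoIntegrand g 0 (α + 1) β c +
        I * β * ((g + I • hermTwo c).adjugate * hermTwo v).trace * xiTwoIntegrand g 0 α (β + 1) c :=
    funext fun c => lineDeriv_xiTwoIntegrand_zero hg α β c v
  rw [hfun]
  show HasDerivAt (fun t : ℝ =>
      -(I * α * ((g - I • hermTwo (c + t • v')).adjugate * hermTwo v).trace) * xiTwoIntegrand g 0 (α + 1) β (c + t • v') +
        I * β * ((g + I • hermTwo (c + t • v')).adjugate * hermTwo v).trace * xiTwoIntegrand g 0 α (β + 1) (c + t • v')) _ 0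
  have hpY : HasDerivAt (fun t : ℝ => ((g - I • hermTwo (c + t • v')).adjugate * hermTwo v).trace)
      (-(I * ((hermTwo v').adjugate * hermTwo v).trace)) 0 := hasLineDerivAt_trace_adjugate_sub_mul g (hermTwo v) c v'
  have hpW : HasDerivAt (fun t : ℝ => ((g + I • hermTwo (c + t • v')).adjugate * hermTwo v).trace)
      (I * ((hermTwo v').adjugate * hermTwo v).trace) 0 := hasLineDerivAt_trace_adjugate_add_mul g (hermTwo v) c v'
  have hΦ1 : HasDerivAt (fun t : ℝ => xiTwoIntegrand g 0 (α + 1) β (c + t • v')) _ 0 := hasLineDerivAt_xiTwoIntegrand_zero hg (α + 1) β c v'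
  have hΦ2 : HasDerivAt (fun t : ℝ => xiTwoIntegrand g 0 α (β + 1) (c + t • v')) _ 0 := hasLineDerivAt_xiTwoIntegrand_zero hg α (β + 1) c v'
  have h := (((hpY.const_mul (I * α)).neg).mul hΦ1).add ((hpW.const_mul (I * β)).mul hΦ2)
  refine h.congr_deriv ?_
  simp only [zero_smul, add_zero, Pi.neg_apply]

/-- The explicit matrices of the four chart directions. -/
theorem hermTwo_dir_a : hermTwo ((1 : ℝ), (0 : ℂ), (0 : ℝ)) = !![1, 0; 0, 0] := by
  ext i j; fin_cases i <;> fin_cases j <;> simp [hermTwo]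

/-- The explicit matrices of the four chart directions. -/
theorem hermTwo_dir_b : hermTwo ((0 : ℝ), (0 : ℂ), (1 : ℝ)) = !![0, 0; 0, 1] := by
  ext i j; fin_cases i <;> fin_cases j <;> simp [hermTwo]

/-- The explicit matrices of the four chart directions. -/
theorem hermTwo_dir_u : hermTwo ((0 : ℝ), (1 : ℂ), (0 : ℝ)) = !![0, 1; 1, 0] := by
  ext i j; fin_cases i <;> fin_cases j <;> simp [hermTwo]

/-- The explicit matrices of the four chart directions. -/
theorem hermTwo_dir_v : hermTwo ((0 : ℝ), I, (0 : ℝ)) = !![0, I; -I, 0] := by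
  ext i j; fin_cases i <;> fin_cases j <;> simp [hermTwo]

/-- Polarisation of `g − ix` against the direction `e_a`. -/
theorem polY_dir_a (g : Matrix (Fin 2) (Fin 2) ℂ) (c : ℝ × ℂ × ℝ) :
    ((g - I • hermTwo c).adjugate * hermTwo ((1 : ℝ), (0 : ℂ), (0 : ℝ))).trace = g 1 1 - I * (c.2.2 : ℂ) := by
  simp [Matrix.adjugate_fin_two, Matrix.trace_fin_two, hermTwo]

/-- Polarisation of `g − ix` against the direction `e_b`. -/
theorem polY_dir_b (g : Matrix (Fin 2) (Fin 2) ℂ) (c : ℝ × ℂ × ℝ) :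
    ((g - I • hermTwo c).adjugate * hermTwo ((0 : ℝ), (0 : ℂ), (1 : ℝ))).trace = g 0 0 - I * (c.1 : ℂ) := by
  simp [Matrix.adjugate_fin_two, Matrix.trace_fin_two, hermTwo]

/-- Polarisation of `g − ix` against the direction `e_u`. -/
theorem polY_dir_u (g : Matrix (Fin 2) (Fin 2) ℂ) (c : ℝ × ℂ × ℝ) :
    ((g - I • hermTwo c).adjugate * hermTwo ((0 : ℝ), (1 : ℂ), (0 : ℝ))).trace = -(g 0 1 - I * c.2.1) - (g 1 0 - I * conj c.2.1) := by
  simp [Matrix.adjugate_fin_two, Matrix.trace_fin_two, hermTwo]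
  ring

/-- Polarisation of `g − ix` against the direction `e_v`. -/
theorem polY_dir_v (g : Matrix (Fin 2) (Fin 2) ℂ) (c : ℝ × ℂ × ℝ) :
    ((g - I • hermTwo c).adjugate * hermTwo ((0 : ℝ), I, (0 : ℝ))).trace = I * (g 0 1 - I * c.2.1) - I * (g 1 0 - I * conj c.2.1) := by
  simp [Matrix.adjugate_fin_two, Matrix.trace_fin_two, hermTwo]
  ring

/-- Polarisation of `g + ix` against the direction `e_a`. -/
theorem polW_dir_a (g : Matrix (Fin 2) (Fin 2) ℂ) (c : ℝ × ℂ × ℝ) :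
    ((g + I • hermTwo c).adjugate * hermTwo ((1 : ℝ), (0 : ℂ), (0 : ℝ))).trace = g 1 1 + I * (c.2.2 : ℂ) := by
  simp [Matrix.adjugate_fin_two, Matrix.trace_fin_two, hermTwo]

/-- Polarisation of `g + ix` against the direction `e_b`. -/
theorem polW_dir_b (g : Matrix (Fin 2) (Fin 2) ℂ) (c : ℝ × ℂ × ℝ) :
    ((g + I • hermTwo c).adjugate * hermTwo ((0 : ℝ), (0 : ℂ), (1 : ℝ))).trace = g 0 0 + I * (c.1 : ℂ) := by
  simp [Matrix.adjugate_fin_two, Matrix.trace_fin_two, hermTwo]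

/-- Polarisation of `g + ix` against the direction `e_u`. -/
theorem polW_dir_u (g : Matrix (Fin 2) (Fin 2) ℂ) (c : ℝ × ℂ × ℝ) :
    ((g + I • hermTwo c).adjugate * hermTwo ((0 : ℝ), (1 : ℂ), (0 : ℝ))).trace = -(g 0 1 + I * c.2.1) - (g 1 0 + I * conj c.2.1) := by
  simp [Matrix.adjugate_fin_two, Matrix.trace_fin_two, hermTwo]
  ring

/-- Polarisation of `g + ix` against the direction `e_v`. -/
theorem polW_dir_v (g : Matrix (Fin 2) (Fin 2) ℂ) (c : ℝ × ℂ × ℝ) :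
    ((g + I • hermTwo c).adjugate * hermTwo ((0 : ℝ), I, (0 : ℝ))).trace = I * (g 0 1 + I * c.2.1) - I * (g 1 0 + I * conj c.2.1) := by
  simp [Matrix.adjugate_fin_two, Matrix.trace_fin_two, hermTwo]
  ring

/-- `tr(adj(e_b) e_a) = 1`. -/
theorem trace_adjugate_dir_b_mul_dir_a :
    ((hermTwo ((0 : ℝ), (0 : ℂ), (1 : ℝ))).adjugate * hermTwo ((1 : ℝ), (0 : ℂ), (0 : ℝ))).trace = 1 := by
  simp [hermTwo_dir_a, hermTwo_dir_b, Matrix.adjugate_fin_two, Matrix.trace_fin_two]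

/-- `tr(adj(e_u) e_u) = −2`. -/
theorem trace_adjugate_dir_u_mul_dir_u :
    ((hermTwo ((0 : ℝ), (1 : ℂ), (0 : ℝ))).adjugate * hermTwo ((0 : ℝ), (1 : ℂ), (0 : ℝ))).trace = -2 := by
  simp [hermTwo_dir_u, Matrix.adjugate_fin_two, Matrix.trace_fin_two]
  norm_num

/-- `tr(adj(e_v) e_v) = −2`. -/
theorem trace_adjugate_dir_v_mul_dir_v :
    ((hermTwo ((0 : ℝ), I, (0 : ℝ))).adjugate * hermTwo ((0 : ℝ), I, (0 : ℝ))).trace = -2 := by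
  simp [hermTwo_dir_v, Matrix.adjugate_fin_two, Matrix.trace_fin_two]
  norm_num

/-- `Σ_L` of `tr(adj(Y)V)tr(adj(Y)V′)` over the Cayley combination of directions is `det Y` (`Y = g − ix`). [folklore] -/
theorem polY_cayley_sum (g : Matrix (Fin 2) (Fin 2) ℂ) (c : ℝ × ℂ × ℝ) :
    ((g - I • hermTwo c).adjugate * hermTwo ((1 : ℝ), (0 : ℂ), (0 : ℝ))).trace * ((g - I • hermTwo c).adjugate * hermTwo ((0 : ℝ), (0 : ℂ), (1 : ℝ))).trace -
        (1 / 4 : ℂ) * (((g - I • hermTwo c).adjugate * hermTwo ((0 : ℝ), (1 : ℂ), (0 : ℝ))).trace ^ 2 +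
          ((g - I • hermTwo c).adjugate * hermTwo ((0 : ℝ), I, (0 : ℝ))).trace ^ 2) = (g - I • hermTwo c).det := by
  have hI3 : I ^ 3 = -I := by rw [pow_succ, Complex.I_sq]; ring
  rw [polY_dir_a, polY_dir_b, polY_dir_u, polY_dir_v, det_sub_I_smul_hermTwo]
  ring_nf
  simp only [Complex.I_sq, hI3, Complex.I_pow_four]
  ring

/-- `Σ_L` of `tr(adj(W)V)tr(adj(W)V′)` is `det W` (`W = g + ix`). [folklore] -/
theorem polW_cayley_sum (g : Matrix (Fin 2) (Fin 2) ℂ) (c : ℝ × ℂ × ℝ) :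
    ((g + I • hermTwo c).adjugate * hermTwo ((1 : ℝ), (0 : ℂ), (0 : ℝ))).trace * ((g + I • hermTwo c).adjugate * hermTwo ((0 : ℝ), (0 : ℂ), (1 : ℝ))).trace -
        (1 / 4 : ℂ) * (((g + I • hermTwo c).adjugate * hermTwo ((0 : ℝ), (1 : ℂ), (0 : ℝ))).trace ^ 2 +
          ((g + I • hermTwo c).adjugate * hermTwo ((0 : ℝ), I, (0 : ℝ))).trace ^ 2) = (g + I • hermTwo c).det := by
  have hI3 : I ^ 3 = -I := by rw [pow_succ, Complex.I_sq]; ring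
  rw [polW_dir_a, polW_dir_b, polW_dir_u, polW_dir_v, det_add_I_smul_hermTwo]
  ring_nf
  simp only [Complex.I_sq, hI3, Complex.I_pow_four]
  ring

/-- `Σ_L` of the MIXED products is the polarisation `det(Y + W) − det Y − det W = 4 det g − det Y − det W` — the carré du champ `Γ(P,Q)`. [folklore] -/
theorem polYW_cayley_sum (g : Matrix (Fin 2) (Fin 2) ℂ) (c : ℝ × ℂ × ℝ) :
    ((g - I • hermTwo c).adjugate * hermTwo ((1 : ℝ), (0 : ℂ), (0 : ℝ))).trace * ((g + I • hermTwo c).adjugate * hermTwo ((0 : ℝ), (0 : ℂ), (1 : ℝ))).trace +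
          ((g + I • hermTwo c).adjugate * hermTwo ((1 : ℝ), (0 : ℂ), (0 : ℝ))).trace * ((g - I • hermTwo c).adjugate * hermTwo ((0 : ℝ), (0 : ℂ), (1 : ℝ))).trace -
        (1 / 4 : ℂ) * (2 * (((g - I • hermTwo c).adjugate * hermTwo ((0 : ℝ), (1 : ℂ), (0 : ℝ))).trace * ((g + I • hermTwo c).adjugate * hermTwo ((0 : ℝ), (1 : ℂ), (0 : ℝ))).trace) +
          2 * (((g - I • hermTwo c).adjugate * hermTwo ((0 : ℝ), I, (0 : ℝ))).trace * ((g + I • hermTwo c).adjugate * hermTwo ((0 : ℝ), I, (0 : ℝ))).trace)) =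
      4 * g.det - (g - I • hermTwo c).det - (g + I • hermTwo c).det := by
  rw [polY_dir_a, polY_dir_b, polY_dir_u, polY_dir_v, polW_dir_a, polW_dir_b, polW_dir_u, polW_dir_v, det_sub_I_smul_hermTwo,
    det_add_I_smul_hermTwo, Matrix.det_fin_two]
  ring_nf
  simp only [Complex.I_sq, Complex.I_pow_four]
  ring

/-- `Σ_L` of the constant terms `tr(adj(V′)V)` is `2`. [folklore] -/
theorem trace_adjugate_cayley_sum :
    ((hermTwo ((0 : ℝ), (0 : ℂ), (1 : ℝ))).adjugate * hermTwo ((1 : ℝ), (0 : ℂ), (0 : ℝ))).trace -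
        (1 / 4 : ℂ) * (((hermTwo ((0 : ℝ), (1 : ℂ), (0 : ℝ))).adjugate * hermTwo ((0 : ℝ), (1 : ℂ), (0 : ℝ))).trace +
          ((hermTwo ((0 : ℝ), I, (0 : ℝ))).adjugate * hermTwo ((0 : ℝ), I, (0 : ℝ))).trace) = 2 := by
  rw [trace_adjugate_dir_b_mul_dir_a, trace_adjugate_dir_u_mul_dir_u, trace_adjugate_dir_v_mul_dir_v]
  norm_num

/-- **THE CAYLEY IDENTITY FOR `Φ_{α,β}`** (`g > 0`; `L := D_bD_a − ¼(D_u² + D_v²)` in the chart directions `e_a = (1,0,0)`, `e_u = (0,1,0)`,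
`e_v = (0,i,0)`, `e_b = (0,0,1)`):
  `L Φ_{α,β} = (α+β−1)·(α Φ_{α+1,β} + β Φ_{α,β+1}) + 4αβ·det(g)·Φ_{α+1,β+1}`.
(Cayley `L P^s = −s(s+1)P^{s−1}` on each factor and the carré du champ `Γ(P,Q) = 2 det g − (P+Q)∕2`; checked at `h = 0` against ★ `xiTwo_zero_right`.)
[cite: Shimura1982, §3] [cite: FarautKoranyi1994, Ch. VII §1] -/
theorem cayley_xiTwoIntegrand_zero {g : Matrix (Fin 2) (Fin 2) ℂ} (hg : g.PosDef) (α β : ℂ) (c : ℝ × ℂ × ℝ) :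
    lineDeriv ℝ (fun c : ℝ × ℂ × ℝ => lineDeriv ℝ (xiTwoIntegrand g 0 α β) c ((1 : ℝ), (0 : ℂ), (0 : ℝ))) c ((0 : ℝ), (0 : ℂ), (1 : ℝ)) -
        (1 / 4 : ℂ) * (lineDeriv ℝ (fun c : ℝ × ℂ × ℝ => lineDeriv ℝ (xiTwoIntegrand g 0 α β) c ((0 : ℝ), (1 : ℂ), (0 : ℝ))) c ((0 : ℝ), (1 : ℂ), (0 : ℝ)) +
          lineDeriv ℝ (fun c : ℝ × ℂ × ℝ => lineDeriv ℝ (xiTwoIntegrand g 0 α β) c ((0 : ℝ), I, (0 : ℝ))) c ((0 : ℝ), I, (0 : ℝ))) =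
      (α + β - 1) * (α * xiTwoIntegrand g 0 (α + 1) β c + β * xiTwoIntegrand g 0 α (β + 1) c) +
        4 * α * β * g.det * xiTwoIntegrand g 0 (α + 1) (β + 1) c := by
  have hP0 := det_sub_I_smul_hermTwo_ne_zero hg c
  have hQ0 := det_add_I_smul_hermTwo_ne_zero hg c
  rw [(hasLineDerivAt_lineDeriv_xiTwoIntegrand_zero hg α β c _ _).lineDeriv, (hasLineDerivAt_lineDeriv_xiTwoIntegrand_zero hg α β c _ _).lineDeriv,
    (hasLineDerivAt_lineDeriv_xiTwoIntegrand_zero hg α β c _ _).lineDeriv]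
  -- the four `Σ_L` identities and the four index relations (no inverses)
  have L1 := polY_cayley_sum g c
  have L2 := polW_cayley_sum g c
  have L3 := polYW_cayley_sum g c
  have L4 := trace_adjugate_cayley_sum
  have hA : (g - I • hermTwo c).det * xiTwoIntegrand g 0 (α + 1 + 1) β c = -xiTwoIntegrand g 0 (α + 1) β c := by
    rw [xiTwoIntegrand_zero_succ_left hg (α + 1) β c]; field_simp
  have hB : (g + I • hermTwo c).det * xiTwoIntegrand g 0 α (β + 1 + 1) c = -xiTwoIntegrand g 0 α (β + 1) c := by
    rw [xiTwoIntegrand_zero_succ_right hg α (β + 1) c]; field_simp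
  have hC : (g - I • hermTwo c).det * xiTwoIntegrand g 0 (α + 1) (β + 1) c = -xiTwoIntegrand g 0 α (β + 1) c := by
    rw [xiTwoIntegrand_zero_succ_left hg α (β + 1) c]; field_simp
  have hD : (g + I • hermTwo c).det * xiTwoIntegrand g 0 (α + 1) (β + 1) c = -xiTwoIntegrand g 0 (α + 1) β c := by
    rw [xiTwoIntegrand_zero_succ_right hg (α + 1) β c]; field_simp
  -- abbreviations
  set pYa := ((g - I • hermTwo c).adjugate * hermTwo ((1 : ℝ), (0 : ℂ), (0 : ℝ))).trace with hpYa
  set pYb := ((g - I • hermTwo c).adjugate * hermTwo ((0 : ℝ), (0 : ℂ), (1 : ℝ))).trace with hpYb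
  set pYu := ((g - I • hermTwo c).adjugate * hermTwo ((0 : ℝ), (1 : ℂ), (0 : ℝ))).trace with hpYu
  set pYv := ((g - I • hermTwo c).adjugate * hermTwo ((0 : ℝ), I, (0 : ℝ))).trace with hpYv
  set pWa := ((g + I • hermTwo c).adjugate * hermTwo ((1 : ℝ), (0 : ℂ), (0 : ℝ))).trace with hpWa
  set pWb := ((g + I • hermTwo c).adjugate * hermTwo ((0 : ℝ), (0 : ℂ), (1 : ℝ))).trace with hpWb
  set pWu := ((g + I • hermTwo c).adjugate * hermTwo ((0 : ℝ), (1 : ℂ), (0 : ℝ))).trace with hpWu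
  set pWv := ((g + I • hermTwo c).adjugate * hermTwo ((0 : ℝ), I, (0 : ℝ))).trace with hpWv
  set tba := ((hermTwo ((0 : ℝ), (0 : ℂ), (1 : ℝ))).adjugate * hermTwo ((1 : ℝ), (0 : ℂ), (0 : ℝ))).trace with htba
  set tuu := ((hermTwo ((0 : ℝ), (1 : ℂ), (0 : ℝ))).adjugate * hermTwo ((0 : ℝ), (1 : ℂ), (0 : ℝ))).trace with htuu
  set tvv := ((hermTwo ((0 : ℝ), I, (0 : ℝ))).adjugate * hermTwo ((0 : ℝ), I, (0 : ℝ))).trace with htvv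
  set P := (g - I • hermTwo c).det with hP
  set Q := (g + I • hermTwo c).det with hQ
  set F10 := xiTwoIntegrand g 0 (α + 1) β c with hF10
  set F01 := xiTwoIntegrand g 0 α (β + 1) c with hF01
  set F20 := xiTwoIntegrand g 0 (α + 1 + 1) β c with hF20
  set F11 := xiTwoIntegrand g 0 (α + 1) (β + 1) c with hF11
  set F02 := xiTwoIntegrand g 0 α (β + 1 + 1) c with hF02
  linear_combination
    ((α * tba * F10 + α * (α + 1) * pYa * pYb * F20 - α * β * pYa * pWb * F11 + β * tba * F01 - α * β * pWa * pYb * F11 + β * (β + 1) * pWa * pWb * F02) -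
      (1 / 4 : ℂ) * ((α * tuu * F10 + α * (α + 1) * pYu * pYu * F20 - α * β * pYu * pWu * F11 + β * tuu * F01 - α * β * pWu * pYu * F11 + β * (β + 1) * pWu * pWu * F02) +
        (α * tvv * F10 + α * (α + 1) * pYv * pYv * F20 - α * β * pYv * pWv * F11 + β * tvv * F01 - α * β * pWv * pYv * F11 + β * (β + 1) * pWv * pWv * F02))) * Complex.I_sq +
    (-α * F10 - β * F01) * L4 + (-α * (α + 1) * F20) * L1 + (-β * (β + 1) * F02) * L2 + (α * β * F11) * L3 +
    (-α * (α + 1)) * hA + (-β * (β + 1)) * hB + (-α * β) * hC + (-α * β) * hD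

/-- **THE CAYLEY IDENTITY FOR THE CHARACTER**: `L e(−τ(hx)) = −4π²·det(h)·e(−τ(hx))` for EVERY complex `2 × 2` matrix `h`. [folklore] -/
theorem cayley_cexp_trace (h : Matrix (Fin 2) (Fin 2) ℂ) (c : ℝ × ℂ × ℝ) :
    lineDeriv ℝ (fun c : ℝ × ℂ × ℝ => lineDeriv ℝ (fun c : ℝ × ℂ × ℝ => cexp (-(2 * Real.pi * I) * (h * hermTwo c).trace)) c ((1 : ℝ), (0 : ℂ), (0 : ℝ)))
          c ((0 : ℝ), (0 : ℂ), (1 : ℝ)) -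
        (1 / 4 : ℂ) *
          (lineDeriv ℝ (fun c : ℝ × ℂ × ℝ => lineDeriv ℝ (fun c : ℝ × ℂ × ℝ => cexp (-(2 * Real.pi * I) * (h * hermTwo c).trace)) c ((0 : ℝ), (1 : ℂ), (0 : ℝ)))
              c ((0 : ℝ), (1 : ℂ), (0 : ℝ)) +
            lineDeriv ℝ (fun c : ℝ × ℂ × ℝ => lineDeriv ℝ (fun c : ℝ × ℂ × ℝ => cexp (-(2 * Real.pi * I) * (h * hermTwo c).trace)) c ((0 : ℝ), I, (0 : ℝ)))
              c ((0 : ℝ), I, (0 : ℝ))) =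
      -(4 * Real.pi ^ 2) * h.det * cexp (-(2 * Real.pi * I) * (h * hermTwo c).trace) := by
  -- the second line derivative of the character in directions `v`, `v′`
  have h2 : ∀ v v' : ℝ × ℂ × ℝ, lineDeriv ℝ (fun c : ℝ × ℂ × ℝ => lineDeriv ℝ (fun c : ℝ × ℂ × ℝ => cexp (-(2 * Real.pi * I) * (h * hermTwo c).trace)) c v) c v' =
      -(2 * Real.pi * I) * (h * hermTwo v).trace * (-(2 * Real.pi * I) * (h * hermTwo v').trace * cexp (-(2 * Real.pi * I) * (h * hermTwo c).trace)) := by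
    intro v v'
    have hfun : (fun c : ℝ × ℂ × ℝ => lineDeriv ℝ (fun c : ℝ × ℂ × ℝ => cexp (-(2 * Real.pi * I) * (h * hermTwo c).trace)) c v) =
        fun c : ℝ × ℂ × ℝ => -(2 * Real.pi * I) * (h * hermTwo v).trace * cexp (-(2 * Real.pi * I) * (h * hermTwo c).trace) :=
      funext fun c => lineDeriv_cexp_trace h c v
    rw [hfun]
    exact HasLineDerivAt.lineDeriv (((hasLineDerivAt_cexp_trace h c v').const_mul (-(2 * Real.pi * I) * (h * hermTwo v).trace)))
  rw [h2, h2, h2, Matrix.det_fin_two]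
  simp only [hermTwo_dir_a, hermTwo_dir_b, hermTwo_dir_u, hermTwo_dir_v, Matrix.trace_fin_two, Matrix.mul_apply, Fin.sum_univ_two,
    Matrix.of_apply, Matrix.cons_val', Matrix.cons_val_zero, Matrix.cons_val_one, Matrix.empty_val', Matrix.cons_val_fin_one]
  ring_nf
  simp only [Complex.I_sq, Complex.I_pow_four]
  ring

end Summit.HodgeConjecture.HodgeConjecture.Cruxes.HLiu418.K2LiuHermTwoXiIntegrandCayley

end
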